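import Summits.AtomisticToContinuum.FouriersLaw.Theses.BondHeatUncertainty
import Summits.AtomisticToContinuum.FouriersLaw.Theorems.ExtensiveSnapshotIrreversibility.Negative.DegenerateInstances
import Literature.MathematicalPhysics.KineticTheory.InfiniteChainObservables
import Literature.Probability.Divergences.FDivVariational

/-!
# `ExtensiveSnapshotIrreversibility` — the snapshot functional `KL(μ ‖ Θ_*μ)` (negative lemmas,
cdisprove cycle 2)

Support file for crux item `stmt-AtomisticToContinuum-9121` (route `BondHeatUncertainty`, decl
`ExtensiveSnapshotIrreversibility`: `KL(μ_{N,T+δ/2,T-δ/2} ‖ Θ_*μ) ≤ C·N·δ²` eventually in `δ`,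
`Θ(q,p) = (q,-p)`).  Structural facts about the functional `μ ↦ KL(μ ‖ Θ_*μ)` on phase space that
constrain both counterexamples and proofs; none asserts the crux.

* `klDiv_flip_symm`: the functional is symmetric, `KL(Θ_*μ ‖ μ) = KL(μ ‖ Θ_*μ)` (the flip is a
  measurable involution) — "snapshot irreversibility" does not depend on which of the two states
  is taken as reference.
* `klDiv_flip_eq_top_of_atom`: an atom of `μ` whose flip is not an atom makes `μ` singular to its
  flip, `KL = ∞`.
* `extensiveSnapshotIrreversibility_obstruction_tvRegular`: **measure-level regularity of the
  response is not enough.**  A family `ν_δ` of probability measures on the one-site phase space,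
  `|δ|`-Lipschitz in total variation at the flip-invariant Gibbs state `ν_0`, can have
  `KL(ν_δ ‖ Θ_*ν_δ) = ∞` for EVERY `δ ≠ 0`.  So any proof of the crux must use density-level
  information on `δ ↦ μ_δ` (absolute continuity with respect to the flip and integrability of the
  log-ratio, i.e. two-sided control of the NESS density), not merely differentiability of
  expectations of bounded observables — exactly the "fixed-`N` debt" flagged on the item.
* `klDiv_flip_ge_odd_variational`, `sq_integral_odd_le_klDiv_flip`: **the snapshot divergence
  dominates every bounded odd observable** (Gibbs/Donsker–Varadhan variational bound with the odd
  test function, transported back by the flip): for measurable `g` with `|g| ≤ 1`, `g ∘ Θ = -g`,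
  `2λ∫g dμ - λ²∫g² dμ ≤ KL(μ ‖ Θ_*μ)` (`0 ≤ λ ≤ 1`), hence `(∫ g dμ)² ≤ KL(μ ‖ Θ_*μ)` on a
  probability space.  Along the NESS, `∫ g dμ_δ ≈ δ·(linear response of g)`, so
  `K_N = limsup δ⁻² KL ≥ (response)²/∫g²`: the `t → 0` (Cauchy–Schwarz) end of the route's
  uncertainty relation, and the mechanism by which a ballistic point (`D_N ≍ N`) forces
  `K_N ≳ N` — the crux's `C·N` is saturated, not beaten, at the excluded harmonic corner.
-/

namespace Summit.AtomisticToContinuum.FouriersLaw.Theorems.ExtensiveSnapshotIrreversibility.Negative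

open MeasureTheory Filter Topology InformationTheory
open scoped ENNReal
open Literature.MathematicalPhysics.KineticTheory.HeatConduction

/-! ### Symmetry and singularity of the snapshot functional -/

/-- Two momentum flips give the identity (as push-forwards). [folklore] -/
theorem map_flip_map_flip {N : ℕ} (μ : Measure (PhaseSpace N)) :
    Measure.map (fun x : PhaseSpace N => (x.1, -x.2))
        (Measure.map (fun x : PhaseSpace N => (x.1, -x.2)) μ) = μ := by
  have hm : Measurable (fun x : PhaseSpace N => (x.1, -x.2)) := (momentumReversal N).measurable
  rw [Measure.map_map hm hm]
  have : ((fun x : PhaseSpace N => (x.1, -x.2)) ∘ (fun x : PhaseSpace N => (x.1, -x.2))) = id := by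
    funext x
    simp
  rw [this, Measure.map_id]

/-- **Snapshot irreversibility is symmetric**: `KL(Θ_*μ ‖ μ) = KL(μ ‖ Θ_*μ)` for every finite
measure `μ` on phase space (the flip is a measurable involution and `KL` is invariant under
measurable equivalences applied to both arguments). [folklore] -/
theorem klDiv_flip_symm {N : ℕ} (μ : Measure (PhaseSpace N)) [IsFiniteMeasure μ] :
    klDiv (Measure.map (fun x : PhaseSpace N => (x.1, -x.2)) μ) μ =
      klDiv μ (Measure.map (fun x : PhaseSpace N => (x.1, -x.2)) μ) := by
  have h := klDiv_map_equiv (momentumReversal N) μ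
    (Measure.map (fun x : PhaseSpace N => (x.1, -x.2)) μ)
  have h2 : Measure.map (momentumReversal N)
      (Measure.map (fun x : PhaseSpace N => (x.1, -x.2)) μ) = μ := map_flip_map_flip μ
  rw [h2] at h
  exact h

/-- **An atom whose flip is not an atom makes `μ` singular to its flip**: `KL(μ ‖ Θ_*μ) = ∞`.
[folklore] -/
theorem klDiv_flip_eq_top_of_atom {N : ℕ} (μ : Measure (PhaseSpace N)) {z : PhaseSpace N}
    (hz : μ {z} ≠ 0) (hΘz : μ {(z.1, -z.2)} = 0) :
    klDiv μ (Measure.map (fun x : PhaseSpace N => (x.1, -x.2)) μ) = ∞ := by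
  have hm : Measurable (fun x : PhaseSpace N => (x.1, -x.2)) := (momentumReversal N).measurable
  refine klDiv_of_not_ac fun h => hz (h ?_)
  rw [Measure.map_apply hm (measurableSet_singleton z)]
  have hset : (fun x : PhaseSpace N => (x.1, -x.2)) ⁻¹' {z} = {(z.1, -z.2)} := by
    ext x
    simp only [Set.mem_preimage, Set.mem_singleton_iff, Prod.ext_iff, neg_eq_iff_eq_neg]
  rw [hset]
  exact hΘz

/-- Points are Lebesgue-null in the phase space of `N ≥ 1` oscillators. [folklore] -/
theorem volume_singleton_phaseSpace {N : ℕ} (hN : 0 < N) (z : PhaseSpace N) :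
    (volume : Measure (PhaseSpace N)) {z} = 0 := by
  haveI : Nonempty (Fin N) := ⟨⟨0, hN⟩⟩
  have : NullSingletonClass (volume : Measure (PhaseSpace N)) :=
    Measure.prod.instNullSingletonClass_fst
  exact measure_singleton z

/-- The Gibbs measure of any chain has no atoms (`N ≥ 1`). [folklore] -/
theorem gibbsMeasure_singleton (P : OscillatorChain) {N : ℕ} (hN : 0 < N) (T : ℝ)
    (z : PhaseSpace N) : P.gibbsMeasure N T {z} = 0 :=
  P.gibbsMeasure_absolutelyContinuous N T (volume_singleton_phaseSpace hN z)

/-- **Obstruction: total-variation regularity of the response does not control the snapshot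
divergence.**  There is a family `ν_δ` of probability measures on the one-site phase space with
`ν_0` the (flip-invariant) Gibbs state of `pinnedChain 1 1 1 1`, `|ν_δ(s) - ν_0(s)| ≤ |δ|` for
every set `s` (so `δ ↦ ν_δ` is Lipschitz in total variation, in particular every bounded
observable responds Lipschitz-continuously), and yet `KL(ν_δ ‖ Θ_*ν_δ) = ∞` for EVERY `δ ≠ 0`:
mix an atom of mass `|δ| ∧ 1` at the point `(q,p) = (0,1)`, which the flip moves.  The family is of
course not a steady-state family; the point is that an argument for
`ExtensiveSnapshotIrreversibility` cannot run on measure-level (weak / TV / bounded-observable)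
response theory alone — it must control the NESS density from both sides (a.c. with respect to
the flip, log-ratio integrable), which is the fixed-`N` content of the crux. [folklore] -/
theorem extensiveSnapshotIrreversibility_obstruction_tvRegular :
    ∃ ν : ℝ → Measure (PhaseSpace 1),
      (∀ δ, IsProbabilityMeasure (ν δ)) ∧
      ν 0 = (pinnedChain 1 1 1 1).gibbsMeasure 1 1 ∧
      Measure.map (fun x : PhaseSpace 1 => (x.1, -x.2)) (ν 0) = ν 0 ∧
      (∀ δ (s : Set (PhaseSpace 1)), |((ν δ) s).toReal - ((ν 0) s).toReal| ≤ |δ|) ∧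
      ∀ δ, δ ≠ 0 → klDiv (ν δ) (Measure.map (fun x : PhaseSpace 1 => (x.1, -x.2)) (ν δ)) = ∞ := by
  set G : Measure (PhaseSpace 1) := (pinnedChain 1 1 1 1).gibbsMeasure 1 1 with hG
  haveI hGp : IsProbabilityMeasure G :=
    pinnedChain_isProbabilityMeasure_gibbsMeasure one_pos zero_le_one zero_le_one 1 1 one_pos
  set zb : PhaseSpace 1 := (fun _ => 0, fun _ => 1) with hzb
  set w : ℝ → ℝ := fun δ => min |δ| 1 with hw
  have hw0 : ∀ δ, 0 ≤ w δ := fun δ => le_min (abs_nonneg δ) zero_le_one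
  have hw1 : ∀ δ, w δ ≤ 1 := fun δ => min_le_right _ _
  have hwδ : ∀ δ, w δ ≤ |δ| := fun δ => min_le_left _ _
  set ν : ℝ → Measure (PhaseSpace 1) := fun δ =>
    ENNReal.ofReal (1 - w δ) • G + ENNReal.ofReal (w δ) • Measure.dirac zb with hν
  have hνapply : ∀ δ (s : Set (PhaseSpace 1)),
      ν δ s = ENNReal.ofReal (1 - w δ) * G s + ENNReal.ofReal (w δ) * Measure.dirac zb s := by
    intro δ s
    simp [hν]
  have hν0 : ν 0 = G := by
    have : w 0 = 0 := by simp [hw]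
    simp [hν, this]
  refine ⟨ν, fun δ => ?_, hν0, ?_, fun δ s => ?_, fun δ hδ => ?_⟩
  · -- probability
    constructor
    rw [hνapply, measure_univ, measure_univ, mul_one, mul_one,
      ← ENNReal.ofReal_add (by linarith [hw1 δ]) (hw0 δ)]
    simp
  · -- flip invariance of the Gibbs state (landed: `gibbsMeasure_map_flip`)
    rw [hν0]
    exact gibbsMeasure_map_flip _ 1 1
  · -- total variation
    rw [hν0, hνapply]
    have hGs : (G s).toReal ≤ 1 := by
      have := ENNReal.toReal_mono ENNReal.one_ne_top (prob_le_one (μ := G) (s := s))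
      simpa using this
    have hGs0 : 0 ≤ (G s).toReal := ENNReal.toReal_nonneg
    have hDs : (Measure.dirac zb s).toReal ≤ 1 := by
      have := ENNReal.toReal_mono ENNReal.one_ne_top
        (prob_le_one (μ := Measure.dirac zb) (s := s))
      simpa using this
    have hDs0 : 0 ≤ (Measure.dirac zb s).toReal := ENNReal.toReal_nonneg
    have hfin1 : ENNReal.ofReal (1 - w δ) * G s ≠ ∞ :=
      ENNReal.mul_ne_top ENNReal.ofReal_ne_top (measure_ne_top G s)
    have hfin2 : ENNReal.ofReal (w δ) * Measure.dirac zb s ≠ ∞ :=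
      ENNReal.mul_ne_top ENNReal.ofReal_ne_top (measure_ne_top _ s)
    rw [ENNReal.toReal_add hfin1 hfin2, ENNReal.toReal_mul, ENNReal.toReal_mul,
      ENNReal.toReal_ofReal (by linarith [hw1 δ]), ENNReal.toReal_ofReal (hw0 δ)]
    have key : (1 - w δ) * (G s).toReal + w δ * (Measure.dirac zb s).toReal - (G s).toReal =
        w δ * ((Measure.dirac zb s).toReal - (G s).toReal) := by ring
    rw [key, abs_mul, abs_of_nonneg (hw0 δ)]
    have hdiff : |(Measure.dirac zb s).toReal - (G s).toReal| ≤ 1 := by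
      rw [abs_le]; constructor <;> linarith
    calc w δ * |(Measure.dirac zb s).toReal - (G s).toReal| ≤ w δ * 1 :=
          mul_le_mul_of_nonneg_left hdiff (hw0 δ)
      _ ≤ |δ| := by rw [mul_one]; exact hwδ δ
  · -- infinite snapshot divergence: `zb` is an atom, its flip is not
    have hwpos : 0 < w δ := lt_min (abs_pos.2 hδ) one_pos
    have hflip : ((zb.1, -zb.2) : PhaseSpace 1) ≠ zb := by
      intro h
      have h2 := congrArg (fun z : PhaseSpace 1 => z.2 0) h
      simp only [hzb, Pi.neg_apply] at h2
      norm_num at h2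
    apply klDiv_flip_eq_top_of_atom (ν δ) (z := zb)
    · rw [hνapply]
      have h1 : Measure.dirac zb {zb} = 1 := by
        rw [Measure.dirac_apply' _ (measurableSet_singleton zb)]; simp
      rw [h1, mul_one]
      have : 0 < ENNReal.ofReal (w δ) := ENNReal.ofReal_pos.2 hwpos
      exact ne_of_gt (lt_of_lt_of_le this le_add_self)
    · rw [hνapply, gibbsMeasure_singleton _ Nat.one_pos, mul_zero, zero_add]
      have h0 : Measure.dirac zb {((zb.1, -zb.2) : PhaseSpace 1)} = 0 := by
        rw [Measure.dirac_apply' _ (measurableSet_singleton _)]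
        simp [Set.indicator, Set.mem_singleton_iff, hflip.symm]
      rw [h0, mul_zero]

/-! ### The snapshot divergence dominates bounded odd observables -/

/-- Elementary: `e^{-y} - 1 ≤ -y + y²` for `|y| ≤ 1`. [folklore] -/
theorem exp_neg_sub_one_le_of_abs_le_one {y : ℝ} (hy : |y| ≤ 1) :
    Real.exp (-y) - 1 ≤ -y + y ^ 2 := by
  have h := Real.abs_exp_sub_one_sub_id_le (x := -y) (by simpa using hy)
  have h' := (abs_le.mp h).2
  nlinarith [h']

/-- **Snapshot irreversibility dominates every bounded odd observable** (variational /
Donsker–Varadhan floor, the odd test function transported back by the flip): for a finite measure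
`μ` on phase space with `KL(μ ‖ Θ_*μ) < ∞`, a measurable `g` with `|g| ≤ 1` and `g ∘ Θ = -g`, and
`0 ≤ λ ≤ 1`: `2λ ∫ g dμ - λ² ∫ g² dμ ≤ KL(μ ‖ Θ_*μ)` (from the Gibbs / Donsker–Varadhan
variational bound, Polyanskiy–Wu 2024 Thm. 7.26, in tree as
`Literature.Probability.Divergences.integral_le_toReal_klDiv_add_integral`). [folklore] -/
theorem klDiv_flip_ge_odd_variational {N : ℕ} (μ : Measure (PhaseSpace N)) [IsFiniteMeasure μ]
    (hfin : klDiv μ (Measure.map (fun x : PhaseSpace N => (x.1, -x.2)) μ) ≠ ∞)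
    {g : PhaseSpace N → ℝ} (hg : Measurable g) (hb : ∀ x, |g x| ≤ 1)
    (hodd : ∀ x : PhaseSpace N, g (x.1, -x.2) = -g x) {l : ℝ} (hl0 : 0 ≤ l) (hl1 : l ≤ 1) :
    2 * l * ∫ x, g x ∂μ - l ^ 2 * ∫ x, g x ^ 2 ∂μ ≤
      (klDiv μ (Measure.map (fun x : PhaseSpace N => (x.1, -x.2)) μ)).toReal := by
  have hm : Measurable (fun x : PhaseSpace N => (x.1, -x.2)) := (momentumReversal N).measurable
  set ν := Measure.map (fun x : PhaseSpace N => (x.1, -x.2)) μ with hν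
  -- integrability of the bounded functions involved
  have hlg_meas : Measurable fun x => l * g x := measurable_const.mul hg
  have hlg_bd : ∀ x, |l * g x| ≤ 1 := fun x => by
    rw [abs_mul, abs_of_nonneg hl0]
    calc l * |g x| ≤ 1 * 1 := mul_le_mul hl1 (hb x) (abs_nonneg _) zero_le_one
      _ = 1 := one_mul 1
  have hint_lg : Integrable (fun x => l * g x) μ :=
    Integrable.mono' (integrable_const (1 : ℝ)) hlg_meas.aestronglyMeasurable
      (ae_of_all _ fun x => by simpa [Real.norm_eq_abs] using hlg_bd x)
  have hexp_meas : Measurable fun x => Real.exp (l * g x) := hlg_meas.exp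
  have hexp_bd : ∀ x, |Real.exp (l * g x)| ≤ Real.exp 1 := fun x => by
    rw [abs_of_pos (Real.exp_pos _)]
    exact Real.exp_le_exp.mpr ((le_abs_self _).trans (hlg_bd x))
  have hint_exp : Integrable (fun x => Real.exp (l * g x)) ν :=
    Integrable.mono' (integrable_const (Real.exp 1)) hexp_meas.aestronglyMeasurable
      (ae_of_all _ fun x => by simpa [Real.norm_eq_abs] using hexp_bd x)
  -- the variational inequality with test function `l g`
  have hDV := Literature.Probability.Divergences.integral_le_toReal_klDiv_add_integral hfin hint_lg
    hint_exp
  -- transport the `ν`-integral back to `μ` and use oddness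
  have hback : ∫ x, (Real.exp (l * g x) - 1) ∂ν = ∫ x, (Real.exp (-(l * g x)) - 1) ∂μ := by
    rw [hν, integral_map hm.aemeasurable]
    · refine integral_congr_ae (ae_of_all _ fun x => ?_)
      simp only [hodd x, mul_neg]
    · exact ((hexp_meas.sub measurable_const).aestronglyMeasurable)
  -- pointwise bound `e^{-y} - 1 ≤ -y + y²`
  have hpt : ∀ x, Real.exp (-(l * g x)) - 1 ≤ -(l * g x) + (l * g x) ^ 2 := fun x =>
    exp_neg_sub_one_le_of_abs_le_one (hlg_bd x)
  have h1 : Integrable (fun x => -(l * g x)) μ := hint_lg.neg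
  have h2 : Integrable (fun x => (l * g x) ^ 2) μ := by
    refine Integrable.mono' (integrable_const (1 : ℝ)) ((hlg_meas.pow_const 2).aestronglyMeasurable)
      (ae_of_all _ fun x => ?_)
    have h1 := hlg_bd x
    rw [Real.norm_eq_abs, abs_pow]
    calc |l * g x| ^ 2 ≤ 1 ^ 2 := pow_le_pow_left₀ (abs_nonneg _) h1 2
      _ = 1 := one_pow 2
  have hint_rhs : Integrable (fun x => -(l * g x) + (l * g x) ^ 2) μ := h1.add h2
  have hint_lhs : Integrable (fun x => Real.exp (-(l * g x)) - 1) μ := by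
    refine Integrable.mono' (integrable_const (Real.exp 1 + 1)) ?_ (ae_of_all _ fun x => ?_)
    · exact ((hlg_meas.neg.exp).sub measurable_const).aestronglyMeasurable
    · rw [Real.norm_eq_abs]
      have h1 : |Real.exp (-(l * g x))| ≤ Real.exp 1 := by
        rw [abs_of_pos (Real.exp_pos _)]
        refine Real.exp_le_exp.mpr ((le_abs_self _).trans ?_)
        rw [abs_neg]; exact hlg_bd x
      calc |Real.exp (-(l * g x)) - 1| ≤ |Real.exp (-(l * g x))| + |(1 : ℝ)| := abs_sub _ _
        _ ≤ Real.exp 1 + 1 := by rw [abs_one]; linarith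
  have hmono : ∫ x, (Real.exp (-(l * g x)) - 1) ∂μ ≤ ∫ x, (-(l * g x) + (l * g x) ^ 2) ∂μ :=
    integral_mono hint_lhs hint_rhs hpt
  have hsplit : ∫ x, (-(l * g x) + (l * g x) ^ 2) ∂μ =
      -(l * ∫ x, g x ∂μ) + l ^ 2 * ∫ x, g x ^ 2 ∂μ := by
    rw [integral_add h1 h2, integral_neg, integral_const_mul]
    simp_rw [mul_pow]
    rw [integral_const_mul]
  have hlin : ∫ x, l * g x ∂μ = l * ∫ x, g x ∂μ := integral_const_mul _ _
  rw [hlin] at hDV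
  rw [hback] at hDV
  linarith [hDV, hmono, hsplit]

/-- **Corollary**: `(∫ g dμ)² ≤ KL(μ ‖ Θ_*μ)` for every measurable odd `g` with `|g| ≤ 1` on a
probability space with finite snapshot divergence (take `λ = |∫ g dμ|`).  Read along the NESS of
the chain with `g` a bounded odd function of the currents: `∫ g dμ_δ = δ·(response) + o(δ)`, so
`K_N = limsup δ⁻² KL ≥ (response)²` — snapshot irreversibility is at least the square of any
bounded odd linear response; a ballistic point forces `K_N ≳ N`. [folklore] -/
theorem sq_integral_odd_le_klDiv_flip {N : ℕ} (μ : Measure (PhaseSpace N)) [IsProbabilityMeasure μ]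
    (hfin : klDiv μ (Measure.map (fun x : PhaseSpace N => (x.1, -x.2)) μ) ≠ ∞)
    {g : PhaseSpace N → ℝ} (hg : Measurable g) (hb : ∀ x, |g x| ≤ 1)
    (hodd : ∀ x : PhaseSpace N, g (x.1, -x.2) = -g x) :
    (∫ x, g x ∂μ) ^ 2 ≤ (klDiv μ (Measure.map (fun x : PhaseSpace N => (x.1, -x.2)) μ)).toReal := by
  -- reduce to `∫ g ≥ 0` by replacing `g` with `-g`
  wlog hpos : 0 ≤ ∫ x, g x ∂μ generalizing g
  · have h := this (g := fun x => -g x) hg.neg (fun x => by simpa using hb x)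
      (fun x => by simp [hodd x]) (by rw [integral_neg]; linarith [le_of_not_ge hpos])
    simpa [integral_neg] using h
  set m := ∫ x, g x ∂μ with hm
  have hm1 : m ≤ 1 := by
    have : ∫ x, g x ∂μ ≤ ∫ x, (1 : ℝ) ∂μ := by
      refine integral_mono ?_ (integrable_const 1) fun x => (le_abs_self _).trans (hb x)
      exact Integrable.mono' (integrable_const (1 : ℝ)) hg.aestronglyMeasurable
        (ae_of_all _ fun x => by simpa [Real.norm_eq_abs] using hb x)
    simpa using this
  have hV1 : ∫ x, g x ^ 2 ∂μ ≤ 1 := by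
    have : ∫ x, g x ^ 2 ∂μ ≤ ∫ x, (1 : ℝ) ∂μ := by
      refine integral_mono ?_ (integrable_const 1) fun x => ?_
      · exact Integrable.mono' (integrable_const (1 : ℝ)) ((hg.pow_const 2).aestronglyMeasurable)
          (ae_of_all _ fun x => by
            rw [Real.norm_eq_abs, abs_pow]
            calc |g x| ^ 2 ≤ 1 ^ 2 := pow_le_pow_left₀ (abs_nonneg _) (hb x) 2
              _ = 1 := one_pow 2)
      · calc g x ^ 2 = |g x| ^ 2 := (sq_abs _).symm
          _ ≤ 1 ^ 2 := pow_le_pow_left₀ (abs_nonneg _) (hb x) 2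
          _ = 1 := one_pow 2
    simpa using this
  have hV0 : 0 ≤ ∫ x, g x ^ 2 ∂μ := integral_nonneg fun x => sq_nonneg _
  have key := klDiv_flip_ge_odd_variational μ hfin hg hb hodd hpos hm1
  rw [← hm] at key
  nlinarith [key, hV1, hV0, sq_nonneg m]

end Summit.AtomisticToContinuum.FouriersLaw.Theorems.ExtensiveSnapshotIrreversibility.Negative
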